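import Literature.AlgebraicGeometry.Modules.SheafHomAffineSections
import Literature.AlgebraicGeometry.Modules.AffineVectorBundleSections
import Literature.AlgebraicGeometry.Morphisms.DevissageClass
import HarnessLib

/-!
# `𝓗om(P, G)` is coherent for `P`, `G` coherent

Hartshorne, *Algebraic Geometry*, II Ex. 5.1 (b)/(c) with Prop. 5.2, and III Prop. 6.8 proof
("`𝓗om(𝓛, 𝓖)` is coherent"); Görtz–Wedhorn I, Prop. 7.29; The Stacks Project, Tag 01CQ (Modules,
Lemma 17.22.6: `𝓗om(𝓕, 𝓖)` is coherent for `𝓕` finitely presented and `𝓖` coherent). In the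
affine-local language of the tree (`Coh M` = affine-localizing + of affine-finite type,
`Morphisms/DevissageClass`; internal Hom `Modules/SheafHom`; `Hom(P|_V, G|_V) = Hom_B(Γ(V, P), Γ(V, G))`
over affine `V = Spec B`, `Modules/SheafHomAffineSections`):

* `isAffineFiniteType_sheafHom` — `Hom(P|_V, G|_V) ↪ Hom_B(Γ(V, P), Γ(V, G))` is finite over the
  noetherian `B` (`X` locally noetherian);
* `isAffineLocalizing_sheafHom` — numerators and torsion on `D(r) ⊆ V`: through the evaluation
  bijections on `V` and on `D(r)`, they are those of `Hom_B(M, N) → Hom_B(M_r, N_r)`, which is a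
  localization at `r` for `M` finitely presented (Mathlib
  `Module.FinitePresentation.isLocalizedModule_map`; Görtz–Wedhorn I Prop. 7.27);
* `coh_sheafHom` — **`𝓗om(P, G)` is coherent**.

Everything is proved; no named facts.

## References

* R. Hartshorne, *Algebraic Geometry*, GTM 52 (1977): II Ex. 5.1, Prop. 5.2 (pp. 110, 123);
  III Prop. 6.8, proof (p. 234). [Hartshorne1977]
* U. Görtz, T. Wedhorn, *Algebraic Geometry I: Schemes*, 2nd ed. (2020): Prop. 7.27, Prop. 7.29.
  [GortzWedhorn2020]
* The Stacks Project, Tag 01CQ. [StacksProject]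
-/

noncomputable section

-- `TopCat.Presheaf`/`TopCat.Sheaf` are not reducible (as in Mathlib's `AlgebraicGeometry/Modules`).
set_option backward.isDefEq.respectTransparency false

open CategoryTheory AlgebraicGeometry Opposite TopologicalSpace
open Literature.AlgebraicGeometry.Morphisms

universe u

namespace Literature.AlgebraicGeometry.Modules

variable {X : Scheme.{u}} {P G : X.Modules}

/-! ### Finite type -/

/-- **`Γ(V, 𝓗om(P, G)) = Hom(P|_V, G|_V)` is a finite `𝒪(V)`-module** for `P` affine-localizing of
affine-finite type, `G` of affine-finite type and `X` locally noetherian: it embeds into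
`Hom_B(Γ(V, P), Γ(V, G))`. [cite: Hartshorne1977, III Prop. 6.8 proof (p. 234)] -/
theorem isAffineFiniteType_sheafHom [IsLocallyNoetherian X] (hP : IsAffineLocalizing P)
    (hPft : IsAffineFiniteType P) (hGft : IsAffineFiniteType G) :
    IsAffineFiniteType (sheafHom P G) := by
  intro V hV
  haveI : IsNoetherianRing Γ(X, V) := IsLocallyNoetherian.component_noetherian ⟨V, hV⟩
  haveI : Module.Finite Γ(X, V) Γ(P, V) := hPft hV
  haveI : Module.Finite Γ(X, V) Γ(G, V) := hGft hV
  haveI : IsNoetherian Γ(X, V) Γ(G, V) := isNoetherian_of_isNoetherianRing_of_finite _ _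
  haveI : IsNoetherian Γ(X, V) (P.over V ⟶ G.over V) :=
    isNoetherian_of_injective (evalHom P G V) (evalHom_injective hP hV)
  change Module.Finite Γ(X, V) (P.over V ⟶ G.over V)
  infer_instance

/-! ### Affine-localizing -/

section Localizing

variable [IsLocallyNoetherian X] (hP : IsAffineLocalizing P) (hPft : IsAffineFiniteType P)
  (hG : IsAffineLocalizing G) {V : X.Opens} (hV : IsAffineOpen V) (r : Γ(X, V))

/-- The `𝒪(V)`-module structure on sections over `D(r)` through `𝒪(V) → 𝒪(D(r))` (local
instance). [folklore] -/
@[reducible]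
def moduleResD (M : X.Modules) : Module Γ(X, V) Γ(M, X.basicOpen r) :=
  Module.compHom _ (algebraMap Γ(X, V) Γ(X, X.basicOpen r))

attribute [local instance] moduleResD

omit [IsLocallyNoetherian X] in
/-- The scalar tower `𝒪(V) → 𝒪(D(r)) ↷ Γ(D(r), M)`. [folklore] -/
theorem isScalarTower_resD (M : X.Modules) :
    IsScalarTower Γ(X, V) Γ(X, X.basicOpen r) Γ(M, X.basicOpen r) :=
  IsScalarTower.of_algebraMap_smul fun _ _ => rfl

attribute [local instance] isScalarTower_resD

/-- Evaluation on `D(r)`-sections with scalars restricted to `𝒪(V)`. [folklore] -/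
abbrev evalResD (ψ : P.over (X.basicOpen r) ⟶ G.over (X.basicOpen r)) :
    Γ(P, X.basicOpen r) →ₗ[Γ(X, V)] Γ(G, X.basicOpen r) :=
  (evalHom P G (X.basicOpen r) ψ).restrictScalars Γ(X, V)

omit [IsLocallyNoetherian X] in
include hP hV in
/-- `evalResD` is injective in `ψ` (for `P` affine-localizing). [folklore] -/
theorem evalResD_injective : Function.Injective (evalResD (P := P) (G := G) r) := fun _ _ h =>
  evalHom_injective hP (hV.basicOpen r) (LinearMap.restrictScalars_injective Γ(X, V) h)

omit [IsLocallyNoetherian X] in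
/-- Naturality: evaluation of the restriction `φ|_{D(r)}` after the restriction map of `P` is the
restriction map of `G` after evaluation of `φ`. [folklore] -/
theorem evalResD_restrictHom_comp (φ : P.over V ⟶ G.over V) :
    evalResD r (restrictHom (homOfLE (X.basicOpen_le r)) φ) ∘ₗ sectionsRestrictₗ P r =
      sectionsRestrictₗ G r ∘ₗ evalHom P G V φ := by
  ext s
  exact evalHom_restrictHom_map (homOfLE (X.basicOpen_le r)) φ s

include hP hPft hG hV in
/-- **Numerators for `𝓗om(P, G)`**: every `ψ : P|_{D(r)} → G|_{D(r)}` is `φ|_{D(r)} / rⁿ` for some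
`φ : P|_V → G|_V` — `Hom_B(M, N) → Hom_B(M_r, N_r)` is a localization at `r` for `M` finitely
presented. [cite: GortzWedhorn2020, Prop. 7.27 and Prop. 7.29] -/
theorem exists_restrictHom_eq_pow_smul (ψ : P.over (X.basicOpen r) ⟶ G.over (X.basicOpen r)) :
    ∃ (n : ℕ) (φ : P.over V ⟶ G.over V),
      restrictHom (homOfLE (X.basicOpen_le r)) φ =
        X.presheaf.map (homOfLE (X.basicOpen_le r)).op r ^ n • ψ := by
  haveI : IsNoetherianRing Γ(X, V) := IsLocallyNoetherian.component_noetherian ⟨V, hV⟩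
  haveI : Module.Finite Γ(X, V) Γ(P, V) := hPft hV
  haveI : Module.FinitePresentation Γ(X, V) Γ(P, V) := Module.finitePresentation_of_finite _ _
  haveI : IsLocalization.Away r Γ(X, X.basicOpen r) := hV.isLocalization_basicOpen r
  haveI := isLocalizedModule_sectionsRestrictₗ P hV r hP
  haveI := isLocalizedModule_sectionsRestrictₗ G hV r hG
  let S := Submonoid.powers r
  -- `rⁿ • ev(ψ)` comes from `Hom_B(M, N)`
  obtain ⟨⟨ℓ₀, ⟨_, n, rfl⟩⟩, hℓ₀⟩ :=
    IsLocalizedModule.surj S (IsLocalizedModule.map S (sectionsRestrictₗ P r) (sectionsRestrictₗ G r))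
      (evalResD r ψ)
  refine ⟨n, homOfLinear hP hV ℓ₀, evalResD_injective hP hV r ?_⟩
  change _ = (evalHom P G (X.basicOpen r) (X.presheaf.map (homOfLE (X.basicOpen_le r)).op r ^ n • ψ)).restrictScalars Γ(X, V)
  rw [map_smul]
  -- both sides are determined by their composite with the localization map of `P`
  apply IsLocalizedModule.ext S (sectionsRestrictₗ P r)
    (IsLocalizedModule.map_units (S := S) (sectionsRestrictₗ G r))
  rw [evalResD_restrictHom_comp, evalHom_homOfLinear]
  have h2 : (⟨r ^ n, n, rfl⟩ : S) • evalResD r ψ =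
      (X.presheaf.map (homOfLE (X.basicOpen_le r)).op r ^ n •
        evalHom P G (X.basicOpen r) ψ).restrictScalars Γ(X, V) := by
    ext s
    change r ^ n • appLE ψ (𝟙 _) s = X.presheaf.map (homOfLE (X.basicOpen_le r)).op r ^ n • appLE ψ (𝟙 _) s
    rw [← map_pow]
    rfl
  rw [← h2, hℓ₀, IsLocalizedModule.map_comp]

omit [IsLocallyNoetherian X] in
include hP hV in
/-- **Torsion for `𝓗om(P, G)`**: a `φ : P|_V → G|_V` vanishing on `D(r)` is killed by a power of
`r` (`P` of affine-finite type on `V`: kill the images of finitely many generators).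
[cite: GortzWedhorn2020, Prop. 7.27 and Prop. 7.29] -/
theorem exists_pow_smul_eq_zero_of_restrictHom [Module.Finite Γ(X, V) Γ(P, V)] (hG : IsAffineLocalizing G)
    (φ : P.over V ⟶ G.over V) (hφ : restrictHom (homOfLE (X.basicOpen_le r)) φ = 0) :
    ∃ n : ℕ, r ^ n • φ = 0 := by
  haveI : IsLocalization.Away r Γ(X, X.basicOpen r) := hV.isLocalization_basicOpen r
  haveI := isLocalizedModule_sectionsRestrictₗ G hV r hG
  let S := Submonoid.powers r
  -- `res_G ∘ ev(φ) = ev(φ|_{D(r)}) ∘ res_P = 0`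
  have h0 : sectionsRestrictₗ G r ∘ₗ evalHom P G V φ = 0 := by
    rw [← evalResD_restrictHom_comp, hφ]
    ext s
    rfl
  -- kill the images of generators
  obtain ⟨T, hT⟩ := Module.Finite.fg_top (R := Γ(X, V)) (M := Γ(P, V))
  have hgen : ∀ m : Γ(P, V), ∃ n : ℕ, r ^ n • evalHom P G V φ m = 0 := fun m => by
    have hm : sectionsRestrictₗ G r (evalHom P G V φ m) = 0 := LinearMap.congr_fun h0 m
    obtain ⟨⟨_, n, rfl⟩, hn⟩ := (IsLocalizedModule.eq_zero_iff S (sectionsRestrictₗ G r)).mp hm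
    exact ⟨n, hn⟩
  classical
  choose n hn using hgen
  refine ⟨T.sup n, evalHom_injective hP hV ?_⟩
  rw [map_smul, map_zero]
  apply LinearMap.ext_on hT
  intro m hm
  rw [LinearMap.smul_apply, LinearMap.zero_apply]
  obtain ⟨d, hd⟩ := Nat.exists_eq_add_of_le (Finset.le_sup (f := n) hm)
  rw [hd, add_comm, pow_add, mul_smul, hn m, smul_zero]

include hP hPft hG in
/-- **`𝓗om(P, G)` is affine-localizing** for `P` coherent and `G` affine-localizing (`X` locally
noetherian). [cite: GortzWedhorn2020, Prop. 7.29] -/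
theorem isAffineLocalizing_sheafHom : IsAffineLocalizing (sheafHom P G) := by
  constructor
  · intro V hV r W hW ψ
    subst hW
    obtain ⟨n, φ, hφ⟩ := exists_restrictHom_eq_pow_smul hP hPft hG hV r ψ
    exact ⟨n, φ, hφ⟩
  · intro V hV r φ W hWV hrW hφ
    haveI : Module.Finite Γ(X, V) Γ(P, V) := hPft hV
    refine exists_pow_smul_eq_zero_of_restrictHom hP hV r hG φ ?_
    have h : restrictHom (homOfLE hrW) (restrictHom (homOfLE hWV) φ) = 0 := by
      change restrictHom (homOfLE hrW) ((sheafHom P G).presheaf.map (homOfLE hWV).op φ) = 0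
      rw [hφ]
      rfl
    rwa [← restrictHom_comp', show homOfLE hrW ≫ homOfLE hWV = homOfLE (X.basicOpen_le r) from
      Subsingleton.elim _ _] at h

end Localizing

/-- **`𝓗om(P, G)` is coherent for `P`, `G` coherent** on a locally noetherian scheme (Hartshorne II
Ex. 5.1 / III Prop. 6.8 proof; GW I Prop. 7.29; Stacks 01CQ).
[cite: Hartshorne1977, III Prop. 6.8 proof (p. 234)] [cite: StacksProject, Tag 01CQ] -/
theorem coh_sheafHom [IsLocallyNoetherian X] (hP : Coh P) (hG : Coh G) : Coh (sheafHom P G) :=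
  ⟨isAffineLocalizing_sheafHom hP.loc hP.ft hG.loc, isAffineFiniteType_sheafHom hP.loc hP.ft hG.ft⟩

end Literature.AlgebraicGeometry.Modules

end
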